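import Summits.QuantumFields.YangMills.Theorems.BalabanUVNodesN15KingModelBoxBlockField
import Summits.QuantumFields.YangMills.Theorems.BalabanUVNodesN15KingModelTimesliceFieldCovariance
import HarnessLib

/-!
# BalabanUVNodes ∕ N15 — THE KING-MODEL RUNG (PART Ν-h): FOLDING PRESERVES THE QUADRATIC FORM, COERCIVITY AND POSITIVITY — KING's RG BLOCK-FIELD LAW
# `dμ^{(K)}_Ω ∝ exp(−½⟨ψ,Δ^{(K)}_Ωψ⟩)dψ` ON THE BOX WITH FREE BOUNDARY CONDITIONS IS A GAUSSIAN PROBABILITY MEASURE WHOSE TWO-POINT FUNCTION IS THE IMAGE SUM OF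
# THE TORUS BLOCK COVARIANCE, WITH TIMESLICES AT THE BLOCK MASS `N·ω₀`
# (Track A, DAG node N15 = NE2; FAN-OUT v1.1 §N15 s3 «KING-MODEL RUNG» — NE2's unit layer on King's region, measure level; count-neutral)

HONEST FRAMING.  Count-neutral (cell `pub-ymgap`, seat `pub-ymgap-dag-n15-e` g39; `--supports stmt-QuantumFields-27366 --as helper` = K3⁸).
TEMPLATE LITERATURE: C. King, Commun. Math. Phys. **102** (1986) 649–677 [King1986] (2.6) p.652 (Gaussian RG measures), (2.14) p.653 (`Δ^{(K)}`), §4 p.670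
(l.8–13: multiple reflections after [Ba 4] (2.42); operators on `Ω` by folding = the doubled-torus form of these files, part Ν-f).  Over parts Ν-f ∕ Ν-g (`foldOp`, `foldOp_effLaplacian_inv`, `timeSlice_fold_blockCov`), part Ν-d (the form identity for `B`) and
part Ϝ-u ∕ Ϲ-f (`gaussLaw`, `covariance_eval_gaussLaw`, `effLaplacian_transpose_eq`) THIS FILE proves: (§1) for EVERY reflection-symmetric torus operator `A`,
★★ **`dotProduct_evenExt_mulVec`** `⟨f∘foldBox, A(f∘foldBox)⟩ = 2^{d+1}·⟨f, fold(A)f⟩`, hence folding preserves coercivity (`foldOp_coercive`: `A ≥ γ ⟹ fold(A) ≥ γ`),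
symmetry and positive definiteness (`foldOp_posDef`); (§2) King's `Δ^{(K)}_Ω = fold(Δ^{(K)})` is coercive (`≥ (a⁻¹+m⁻²)⁻¹`, the torus floor) and positive definite,
the RG block-field law on `Ω` with free boundary conditions `gaussLaw (fold Δ^{(K)})` is a probability measure, ★★★ **`cov_eval_boxBlockFieldLaw`** — its two-point
function is `Σ_S (Δ^{(K)}_{T(2n)})⁻¹(dblBox b, σ_S dblBox b′)`, THE IMAGE SUM OF THE TORUS BLOCK COVARIANCE — it IS `N(0, fold((Δ^{(K)})⁻¹))`
(`boxBlockFieldLaw_eq_gaussianFieldOfKernel`), and ★★ its zero-momentum timeslice two-point function (King's units, slice `α ≠ t_κ`) is part Ν-g's four-term form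
at the BLOCK MASS `N·ω₀` (`timeSlice_cov_boxBlockFieldLaw`).
NOT Bałaban's covariant objects; NOT a node discharge (N15 is booked through n15-a's knit, untouched); reflection positivity of the block-field law on `Ω` is
NOT asserted here (`Δ^{(K)}` is not nearest-neighbour; on the torus it came from the two-level push-forward, part Ϗ-372); nothing continuum-YM ∕ `ℝ⁴` ∕ OS
axioms ∕ Clay.  0 `sorry`, 0 `def`.

WHAT THIS FILE PROVES (kernel).  §1 ★ `mulVec_evenExt_torReflS`, ★★ **`dotProduct_evenExt_mulVec`**, ★★ `foldOp_coercive`, `foldOp_transpose_eq`, ★ `foldOp_posDef`.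
§2 ★ `foldOp_effLaplacian_coercive`, ★ `foldOp_effLaplacian_posDef`, `isProbabilityMeasure_boxBlockFieldLaw`, ★★★ **`cov_eval_boxBlockFieldLaw`**,
`boxBlockFieldLaw_eq_gaussianFieldOfKernel`, ★★ `timeSlice_cov_boxBlockFieldLaw`.

HONEST SCOPE.  `a > 0`, `c ≥ 0`, `m² > 0` (`c = N²`, `N ≥ 1`, `α ≠ t_κ` for the timeslice form); any `d`, any sides `n_μ ≥ 1`.  King's `A = 0` scalar model; N15
untouched; counts unmoved.  Locators: [King1986] (2.6) p.652, (2.14) p.653, §4 p.670; [MontvayMunster1994] §2.2.1 (2.74)–(2.82).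
-/

noncomputable section

open scoped BigOperators symmDiff
open Finset Matrix MeasureTheory ProbabilityTheory

namespace Summit.QuantumFields.YangMills.BalabanUVNodes.N15KingModelRung.TorusSpectral

open Literature.MathematicalPhysics.QuantumFieldTheory (IsPosSemidefKernel gaussianFieldOfKernel)
open Literature.MathematicalPhysics.QuantumFieldTheory.Balaban1983to89.B5Prop11Plancherel (Tor fine unitVec)
open Literature.MathematicalPhysics.QuantumFieldTheory.Balaban1983to89.QGQInverse (Coercive isUnit_of_coercive)
open Literature.MathematicalPhysics.QuantumFieldTheory.King1986.Torus
open Literature.Probability.LatticeModels (mulVec_comp_equiv_eq)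
open Summit.QuantumFields.YangMills.BalabanUVNodes.N15.TwoGrid (torRefl torRefl_torRefl torRefl_apply_same torRefl_apply_ne)
open Summit.QuantumFields.YangMills.BalabanUVNodes.N15KingModelRung.Curved (effLaplacian_torRefl effLaplacian_inv_torRefl)
open Summit.QuantumFields.YangMills.BalabanUVNodes.N15KingModelRung.FreeField (gaussLaw gaussLaw_eq_gaussianFieldOfKernel isProbabilityMeasure_gaussLaw
  covariance_eval_gaussLaw)

variable {d : ℕ}

/-! ## §1 The folded quadratic form: `⟨f∘fold, A(f∘fold)⟩ = 2^{d+1}⟨f, fold(A)f⟩` for every reflection-symmetric `A` -/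

section FoldForm

variable (n : Fin (d + 1) → ℕ) [hn : ∀ μ, NeZero (n μ)]

/-- A reflection-symmetric operator maps `σ`-even functions to `σ`-even functions: `(A(f∘foldBox))(σ_S w) = (A(f∘foldBox))(w)`. [cite: King1986, §4 p.670] -/
theorem mulVec_evenExt_torReflS {A : Matrix (Tor (dblPer n)) (Tor (dblPer n)) ℝ} (hA : IsReflSymm n A) (f : KingBox n → ℝ)
    (S : Finset (Fin (d + 1))) (w : Tor (dblPer n)) :
    (A *ᵥ fun w' => f (foldBox n w')) (torReflS (dblPer n) S w) = (A *ᵥ fun w' => f (foldBox n w')) w := by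
  have hθ := mulVec_comp_equiv_eq (A := A) (θ := Function.Involutive.toPerm (torReflS (dblPer n) S) (torReflS_torReflS (dblPer n) S))
    (torReflS_torReflS (dblPer n) S) (fun x y => hA S x y) (fun w' => f (foldBox n w'))
  have heven : (fun y => f (foldBox n ((Function.Involutive.toPerm (torReflS (dblPer n) S) (torReflS_torReflS (dblPer n) S)) y)))
      = fun w' => f (foldBox n w') := by
    funext y
    show f (foldBox n (torReflS (dblPer n) S y)) = f (foldBox n y)
    rw [foldBox_torReflS]
  rw [heven] at hθ
  have h : (A *ᵥ fun w' => f (foldBox n w')) w = (A *ᵥ fun w' => f (foldBox n w')) (torReflS (dblPer n) S w) := congr_fun hθ w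
  exact h.symm

/-- ★★ **THE FOLDED FORM**: `⟨f∘foldBox, A(f∘foldBox)⟩ = 2^{d+1}·⟨f, fold(A)f⟩` for reflection-symmetric `A` (part Ν-d for `A = B`). [cite: King1986, §4 p.670] -/
theorem dotProduct_evenExt_mulVec {A : Matrix (Tor (dblPer n)) (Tor (dblPer n)) ℝ} (hA : IsReflSymm n A) (f : KingBox n → ℝ) :
    (fun w => f (foldBox n w)) ⬝ᵥ (A *ᵥ fun w => f (foldBox n w)) = 2 ^ (d + 1) * (f ⬝ᵥ (foldOp n A *ᵥ f)) := by
  simp only [dotProduct]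
  rw [sum_dblTorus_eq_sum_images]
  have hterm : ∀ (S : Finset (Fin (d + 1))) (s : KingBox n),
      f (foldBox n (torReflS (dblPer n) S (dblBox n s))) * (A *ᵥ fun w => f (foldBox n w)) (torReflS (dblPer n) S (dblBox n s))
        = f s * (foldOp n A *ᵥ f) s := by
    intro S s
    rw [foldBox_torReflS_dblBox, mulVec_evenExt_torReflS n hA, foldOp_mulVec]
  simp_rw [hterm]
  rw [Finset.sum_const, Finset.card_univ, Fintype.card_finset, Fintype.card_fin, nsmul_eq_mul]
  push_cast; ring

/-- ★★ **FOLDING PRESERVES COERCIVITY**: `A ≥ γ` on the torus ⟹ `fold(A) ≥ γ` on the box (reflection-symmetric `A`). [cite: King1986, §4 p.670] -/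
theorem foldOp_coercive {A : Matrix (Tor (dblPer n)) (Tor (dblPer n)) ℝ} (hA : IsReflSymm n A) {γ : ℝ} (hco : Coercive A γ) : Coercive (foldOp n A) γ := by
  intro f
  have h := hco (fun w => f (foldBox n w))
  rw [dotProduct_evenExt_mulVec n hA, dotProduct_evenExt_self] at h
  have hpos : (0 : ℝ) < 2 ^ (d + 1) := by positivity
  nlinarith

omit hn in
/-- Folding preserves symmetry: `fold(A)ᵀ = fold(A)` for symmetric reflection-symmetric `A`. [folklore] -/
theorem foldOp_transpose_eq {A : Matrix (Tor (dblPer n)) (Tor (dblPer n)) ℝ} (hA : IsReflSymm n A) (hT : Aᵀ = A) : (foldOp n A)ᵀ = foldOp n A := by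
  rw [← foldOp_transpose n hA, hT]

/-- ★ **FOLDING PRESERVES POSITIVE DEFINITENESS** (symmetric, reflection-symmetric, coercive with `γ > 0`). [cite: King1986, §4 p.670] -/
theorem foldOp_posDef {A : Matrix (Tor (dblPer n)) (Tor (dblPer n)) ℝ} (hA : IsReflSymm n A) (hT : Aᵀ = A) {γ : ℝ} (hγ : 0 < γ) (hco : Coercive A γ) :
    (foldOp n A).PosDef := by
  refine Matrix.PosDef.of_dotProduct_mulVec_pos ?_ fun x hx => ?_
  · show (foldOp n A)ᴴ = foldOp n A
    rw [Matrix.conjTranspose_eq_transpose_of_trivial, foldOp_transpose_eq n hA hT]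
  · rw [star_trivial]
    have hcoe := foldOp_coercive n hA hco x
    have hxx0 : 0 ≤ x ⬝ᵥ x := Finset.sum_nonneg fun i _ => mul_self_nonneg _
    have hxx : x ⬝ᵥ x ≠ 0 := fun h0 => hx (dotProduct_self_eq_zero.mp h0)
    have hxxp : 0 < x ⬝ᵥ x := lt_of_le_of_ne hxx0 (Ne.symm hxx)
    nlinarith [mul_pos hγ hxxp]

end FoldForm

/-! ## §2 King's RG block-field law on the box with free boundary conditions -/

section BlockFieldLaw

variable (N : ℕ) [NeZero N] (n : Fin (d + 1) → ℕ) [hn : ∀ μ, NeZero (n μ)]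

/-- ★ **KING's EFFECTIVE LAPLACIAN ON `Ω` IS COERCIVE**: `⟨f, Δ^{(K)}_Ω f⟩ ≥ (a⁻¹+m⁻²)⁻¹⟨f,f⟩` (`a > 0`, `c ≥ 0`, `m² > 0`; the torus floor, folded). [cite: King1986, (2.14) p.653, §4 p.670] -/
theorem foldOp_effLaplacian_coercive {a c m2 : ℝ} (ha : 0 < a) (hc : 0 ≤ c) (hm : 0 < m2) :
    Coercive (foldOp n (effLaplacian N (dblPer n) a c m2)) ((a⁻¹ + m2⁻¹)⁻¹) :=
  foldOp_coercive n (isReflSymm_effLaplacian N n a c m2) (effLaplacian_coercive_of_nonneg N (dblPer n) ha hc hm)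

/-- ★ `Δ^{(K)}_Ω` is positive definite. [cite: King1986, (2.14) p.653, §4 p.670] -/
theorem foldOp_effLaplacian_posDef {a c m2 : ℝ} (ha : 0 < a) (hc : 0 ≤ c) (hm : 0 < m2) : (foldOp n (effLaplacian N (dblPer n) a c m2)).PosDef :=
  foldOp_posDef n (isReflSymm_effLaplacian N n a c m2) (effLaplacian_transpose_eq N (dblPer n) a c m2) (by positivity)
    (effLaplacian_coercive_of_nonneg N (dblPer n) ha hc hm)

/-- KING's RG BLOCK-FIELD LAW ON `Ω` WITH FREE BOUNDARY CONDITIONS, `dμ^{(K)}_Ω = ρ_{Δ^{(K)}_Ω}(ψ)dψ ∝ exp(−½⟨ψ, Δ^{(K)}_Ωψ⟩)dψ`, is a probability measure.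
[cite: King1986, (2.6) p.652, (2.14) p.653, §4 p.670] -/
theorem isProbabilityMeasure_boxBlockFieldLaw {a c m2 : ℝ} (ha : 0 < a) (hc : 0 ≤ c) (hm : 0 < m2) :
    IsProbabilityMeasure (gaussLaw (foldOp n (effLaplacian N (dblPer n) a c m2))) :=
  isProbabilityMeasure_gaussLaw (by positivity) (foldOp_effLaplacian_coercive N n ha hc hm)

/-- ★★★ **THE TWO-POINT FUNCTION OF KING's RG BLOCK FIELD ON `Ω` WITH FREE BOUNDARY CONDITIONS IS THE IMAGE SUM OF THE TORUS BLOCK COVARIANCE**: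
`Cov(ψ(b), ψ(b′)) = Σ_{S⊆{0,…,d}} (Δ^{(K)}_{T(2n)})⁻¹(dblBox b, σ_S dblBox b′)` under `dμ^{(K)}_Ω` (`a > 0`, `c ≥ 0`, `m² > 0`) — NE2's unit-lattice kernel on King's
region, at the level of the MEASURE. [cite: King1986, (2.6) p.652, (2.14) p.653, §4 p.670] -/
theorem cov_eval_boxBlockFieldLaw {a c m2 : ℝ} (ha : 0 < a) (hc : 0 ≤ c) (hm : 0 < m2) (b b' : KingBox n) :
    cov[fun ψ : KingBox n → ℝ => ψ b, fun ψ : KingBox n → ℝ => ψ b'; gaussLaw (foldOp n (effLaplacian N (dblPer n) a c m2))]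
      = ∑ S : Finset (Fin (d + 1)), (effLaplacian N (dblPer n) a c m2)⁻¹ (dblBox n b) (torReflS (dblPer n) S (dblBox n b')) := by
  rw [covariance_eval_gaussLaw (by positivity) (foldOp_effLaplacian_coercive N n ha hc hm)
    (foldOp_transpose_eq n (isReflSymm_effLaplacian N n a c m2) (effLaplacian_transpose_eq N (dblPer n) a c m2)),
    foldOp_effLaplacian_inv_apply N n ha hc hm]

/-- The block-field law on `Ω` is the centred Gaussian field with covariance kernel `fold((Δ^{(K)})⁻¹)`. [cite: King1986, (2.6) p.652, §4 p.670] -/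
theorem boxBlockFieldLaw_eq_gaussianFieldOfKernel {a c m2 : ℝ} (ha : 0 < a) (hc : 0 ≤ c) (hm : 0 < m2) :
    gaussLaw (foldOp n (effLaplacian N (dblPer n) a c m2))
      = gaussianFieldOfKernel fun b b' : KingBox n => foldOp n (effLaplacian N (dblPer n) a c m2)⁻¹ b b' := by
  rw [gaussLaw_eq_gaussianFieldOfKernel (by positivity) (foldOp_effLaplacian_coercive N n ha hc hm)
    (foldOp_transpose_eq n (isReflSymm_effLaplacian N n a c m2) (effLaplacian_transpose_eq N (dblPer n) a c m2))]
  congr 1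
  funext b b'
  rw [foldOp_effLaplacian_inv N n ha hc hm]

/-- ★★ **THE TIMESLICE TWO-POINT FUNCTION OF THE RG BLOCK FIELD ON `Ω`** (King's units `c = N²`, slice `α ≠ t_κ`): direct term, periodic image and two
Neumann images at the BLOCK MASS `N·ω₀` (part Ν-g `timeSlice_fold_blockCov`, read under the measure). [cite: King1986, (2.14) p.653, §4 p.670; MontvayMunster1994, §2.2.1 (2.74)–(2.82)] -/
theorem timeSlice_cov_boxBlockFieldLaw (hN1 : 1 ≤ N) {a m2 : ℝ} (ha : 0 < a) (hm : 0 < m2) (κ : Fin (d + 1)) (t : KingBox n) {α : Fin (n κ)}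
    (hα : α ≠ t κ) :
    ∑ b' : KingBox n, (if b' κ = α then
        cov[fun ψ : KingBox n → ℝ => ψ b', fun ψ : KingBox n → ℝ => ψ t; gaussLaw (foldOp n (effLaplacian N (dblPer n) a ((N : ℝ) ^ 2) m2))] else 0)
      = ((N : ℝ) ^ 3)⁻¹
          * ((Real.sinh (N * latticeMass (m2 / (N : ℝ) ^ 2) / 2) / Real.sinh (latticeMass (m2 / (N : ℝ) ^ 2) / 2)) ^ 2
            / (2 * Real.sinh (latticeMass (m2 / (N : ℝ) ^ 2)) * (1 - Real.exp (-(latticeMass (m2 / (N : ℝ) ^ 2) * N * (2 * n κ : ℕ))))))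
          * ((Real.exp (-(latticeMass (m2 / (N : ℝ) ^ 2) * N * |((α.val : ℝ) - (t κ).val)|))
              + Real.exp (-(latticeMass (m2 / (N : ℝ) ^ 2) * N * ((2 * n κ : ℕ) - |((α.val : ℝ) - (t κ).val)|))))
            + (Real.exp (-(latticeMass (m2 / (N : ℝ) ^ 2) * N * ((2 * n κ - 1 - (α.val + (t κ).val) : ℕ) : ℝ)))
              + Real.exp (-(latticeMass (m2 / (N : ℝ) ^ 2) * N * ((α.val : ℝ) + (t κ).val + 1))))) := by
  have h : ∀ b' : KingBox n,
      cov[fun ψ : KingBox n → ℝ => ψ b', fun ψ : KingBox n → ℝ => ψ t; gaussLaw (foldOp n (effLaplacian N (dblPer n) a ((N : ℝ) ^ 2) m2))]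
        = (foldOp n (effLaplacian N (dblPer n) a ((N : ℝ) ^ 2) m2))⁻¹ b' t := by
    intro b'
    rw [covariance_eval_gaussLaw (by positivity) (foldOp_effLaplacian_coercive N n ha (by positivity) hm)
      (foldOp_transpose_eq n (isReflSymm_effLaplacian N n a _ m2) (effLaplacian_transpose_eq N (dblPer n) a _ m2))]
  simp_rw [h]
  exact timeSlice_fold_blockCov N n κ hN1 ha hm t hα

end BlockFieldLaw

end Summit.QuantumFields.YangMills.BalabanUVNodes.N15KingModelRung.TorusSpectral
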